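import Literature.Computability.AlgebraicComplexity.GenericSubspaceChartCriterion
import Mathlib.LinearAlgebra.Matrix.Charpoly.Coeff
import HarnessLib

/-!
# Generic ternary forms of degree `D ≥ 4` have no regular unipotent symmetry (every field)

Topic `Literature/Computability/AlgebraicComplexity` (cell `val-lit`, row X3-Poonen05). Theorems only —
no definition, no named fact.

One conjugacy class in the Matsumura–Monsky count behind Poonen 2005 Thm. 3 ("the generic
hypersurface has `Lin X = {1}`"; for plane curves, `n = 1`, `d ≥ 4`: [Ch] in characteristic `0`,
[KS, 10.6.18] in general — attribution only, neither source is held), done over EVERY field: the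
REGULAR unipotent class of `GL₃` (`u = 1 + N`, `N` nilpotent, `N² ≠ 0`).

* § 1 `coeff_aeval_kill_of_apply_eq_zero` — the coefficient of a monomial not involving `x_{j₀}` is
  unchanged by the substitution `x_{j₀} ↦ 0` (bookkeeping for coefficient extraction).
* § 2 The model `u₀ = 1 + J`, `J = E₀₁ + E₁₂` (`x₀ ↦ x₀`, `x₁ ↦ x₁ + x₀`, `x₂ ↦ x₂ + x₁` under the
  tree's `linSubst`), and `2D` forms of degree `D` whose images under `u₀ - 1` are linearly
  independent: `x₂^a x₀^{D-a}` (`1 ≤ a ≤ D`; test functional = coefficient of `x₁^a x₀^{D-a}`) and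
  `x₂^a x₁ x₀^{D-1-a}` (`0 ≤ a < D`; test functional = coefficient of `x₂^a x₀^{D-a}`) — a block
  unitriangular system (`linearIndependent_sum_of_triangular_dual_family`), hence
  `dim (Sym^D K³)^{u₀} ≤ N - 2D` (`finrank_fixedForms_add_card_le_card_degMonomials`).
* § 3 The chart: for `u = 1 + N` with `N³ = 0 ≠ N² eᵢ`, the matrix `P = [N² eᵢ | N eᵢ | eᵢ]` is
  invertible and `u P = P u₀`; it has `6 = dim(class)` polynomial parameters (the two columns
  `N² eᵢ`, `N eᵢ`), three charts `i = 0, 1, 2`.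
* § 4 **`isZariskiGeneric_forall_mem_linStabilizer_unipotent_sq_eq_zero`** — over EVERY field, for
  `D ≥ 4`, almost all ternary forms `f` of degree `D` admit no `u ∈ stab(f)` with `u - 1` nilpotent
  and `(u - 1)² ≠ 0`: the count `6 + (N - 2D) < N ⇔ D ≥ 4` fed to
  `isZariskiGeneric_forall_mem_linStabilizer_mul_ne`.

What stays open / honest framing. This is ONE class of the count; the transvection class (`(u-1)² = 0`,
positive characteristic) and the assembly "Poonen Thm. 3 for plane curves" are separate files of the
same seat; the general `(m, D)` residue of `poonen2005_thm_3` in characteristic `p` (Jordan types of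
rank `≥ 2` for `m ≥ 4`) stays XL and is NOT claimed. Classical mathematics ([MatsumuraMonsky1963],
[Poonen2005]); typed ≠ endorsed; nothing here bears on VP versus VNP, which is NOT proved.

## References

* B. Poonen, *Varieties without extra automorphisms III: hypersurfaces*, Finite Fields Appl. 11
  (2005) 230–268, Thm. 3 (held, p0002:L17–21). [Poonen2005]
* H. Matsumura, P. Monsky, *On the automorphisms of hypersurfaces*, J. Math. Kyoto Univ. 3 (1963/64)
  347–361 (the count over conjugacy classes; not held, acq-11400). [MatsumuraMonsky1963]

## Tree

`isZariskiGeneric_forall_mem_linStabilizer_mul_ne`, `finrank_fixedForms_add_card_le_card_degMonomials`,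
`linearIndependent_sum_of_triangular_dual_family` (`GenericSubspaceChartCriterion`); `linSubst_X`,
`linStabilizer`, `IsZariskiGeneric`, `IsZariskiGeneric.forall_fintype`, `degMonomials`.

## Provenance

Cell `val-lit`, seat `val-lit-x3` generation 9 (cross-ladder literature seat; row X3 residue).
-/

noncomputable section

open MvPolynomial

namespace Literature.Computability.AlgebraicComplexity

/-! ### § 1 Killing a variable does not change the coefficients of monomials avoiding it -/

section Kill

variable {σ : Type*} [DecidableEq σ] {K : Type*} [Field K]

/-- The substitution `x_{j₀} ↦ 0` (other variables unchanged) does not change the coefficient of a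
monomial `x^e` with `e_{j₀} = 0` (bookkeeping for reading off coefficients in the fixed-space bounds
of the Matsumura–Monsky count). [cite: Poonen2005, Thm. 3 (proof: dimension count of [MM];
coefficient bookkeeping)] -/
theorem coeff_aeval_kill_of_apply_eq_zero (j₀ : σ) (g : MvPolynomial σ K) {e : σ →₀ ℕ}
    (he : e j₀ = 0) :
    coeff e (aeval (fun j => if j = j₀ then (0 : MvPolynomial σ K) else X j) g) = coeff e g := by
  induction g using MvPolynomial.induction_on' with
  | monomial e' c =>
    by_cases h0 : e' j₀ = 0
    · -- on the support of `e'` the substitution is the identity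
      have hX : aeval (fun j => if j = j₀ then (0 : MvPolynomial σ K) else X j) (monomial e' c) =
          aeval X (monomial e' c) := by
        rw [aeval_monomial, aeval_monomial]
        congr 1
        refine Finsupp.prod_congr fun j hj => ?_
        have hj' : j ≠ j₀ := by
          rintro rfl
          exact (Finsupp.mem_support_iff.mp hj) h0
        rw [if_neg hj']
      rw [hX, aeval_X_left, AlgHom.id_apply]
    · -- the monomial involves `x_{j₀}` and is killed; and `e ≠ e'`
      have hz : aeval (fun j => if j = j₀ then (0 : MvPolynomial σ K) else X j) (monomial e' c) = 0 := by
        rw [aeval_monomial]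
        refine mul_eq_zero_of_right _ (Finset.prod_eq_zero (Finsupp.mem_support_iff.mpr h0) ?_)
        simp only [if_true]
        exact zero_pow h0
      have hne : e' ≠ e := by
        rintro rfl
        exact h0 he
      rw [hz, coeff_zero, coeff_monomial, if_neg hne]
  | add p q hp hq => simp only [map_add, coeff_add, hp, hq]

end Kill

/-! ### § 2 The model regular unipotent matrix of `GL₃` and its fixed forms -/

section Model

variable {K : Type*} [Field K]

/-- The model substitution on the variables: with `u₀ = 1 + E₀₁ + E₁₂`, the tree's `linSubst u₀` maps
`x₀ ↦ x₀`. [cite: Poonen2005, Thm. 3 (proof: dimension count of [MM]; normal form of a class)] -/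
theorem linSubst_regularModel_X_zero :
    linSubst (Fin 3) K (1 + (Matrix.single 0 1 (1 : K) + Matrix.single 1 2 1)) (X 0) = X 0 := by
  simp [linSubst_X, Matrix.add_apply, Matrix.one_apply]

/-- … `x₁ ↦ x₀ + x₁`. [cite: Poonen2005, Thm. 3 (proof: dimension count of [MM]; normal form of a class)] -/
theorem linSubst_regularModel_X_one :
    linSubst (Fin 3) K (1 + (Matrix.single 0 1 (1 : K) + Matrix.single 1 2 1)) (X 1) = X 0 + X 1 := by
  simp [linSubst_X, Fin.sum_univ_three, Matrix.add_apply, Matrix.one_apply, Matrix.single_apply]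

/-- … `x₂ ↦ x₁ + x₂`. [cite: Poonen2005, Thm. 3 (proof: dimension count of [MM]; normal form of a class)] -/
theorem linSubst_regularModel_X_two :
    linSubst (Fin 3) K (1 + (Matrix.single 0 1 (1 : K) + Matrix.single 1 2 1)) (X 2) = X 1 + X 2 := by
  simp [linSubst_X, Fin.sum_univ_three, Matrix.add_apply, Matrix.one_apply, Matrix.single_apply]

/-- Equality of two-letter exponent vectors `x₁^a x₀^c = x₁^{a'} x₀^{c'}` forces `a = a'`.
[cite: Poonen2005, Thm. 3 (proof: dimension count of [MM]; coefficient bookkeeping)] -/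
theorem eq_of_single_add_single_eq {i j : Fin 3} (hij : i ≠ j) {a c a' c' : ℕ}
    (h : Finsupp.single i a + Finsupp.single j c = Finsupp.single i a' + Finsupp.single j c') :
    a = a' := by
  have := DFunLike.congr_fun h i
  simpa [Finsupp.single_apply, hij.symm] using this

/-- **`2D` independent images of `u₀ - 1` on `Sym^D K³`.** For the model `u₀ = 1 + E₀₁ + E₁₂` the
images under `u₀ - 1` of the `2D` forms `x₂^{a+1} x₀^{D-1-a}` and `x₂^a x₁ x₀^{D-1-a}` (`0 ≤ a < D`)
are linearly independent: the coefficient of `x₁^{a+1} x₀^{D-1-a}`, resp. of `x₂^a x₀^{D-a}`, is a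
block-unitriangular system of test functionals (read off after killing `x₂`, resp. `x₁`).
[cite: Poonen2005, Thm. 3 (proof: dimension count of [MM]; fixed forms of the regular unipotent
class)] -/
theorem linearIndependent_regularModel_images (D : ℕ) :
    LinearIndependent K fun i : Fin D ⊕ Fin D =>
      linSubst (Fin 3) K (1 + (Matrix.single 0 1 (1 : K) + Matrix.single 1 2 1))
          (Sum.elim (fun a : Fin D => X 2 ^ ((a : ℕ) + 1) * X 0 ^ (D - 1 - a))
            (fun a : Fin D => X 2 ^ (a : ℕ) * X 1 * X 0 ^ (D - 1 - a)) i) -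
        Sum.elim (fun a : Fin D => X 2 ^ ((a : ℕ) + 1) * X 0 ^ (D - 1 - a))
          (fun a : Fin D => (X 2 ^ (a : ℕ) * X 1 * X 0 ^ (D - 1 - a) : MvPolynomial (Fin 3) K)) i := by
  classical
  -- the test functionals
  refine linearIndependent_sum_of_triangular_dual_family _
    (Sum.elim (fun a : Fin D => lcoeff K (Finsupp.single 1 ((a : ℕ) + 1) + Finsupp.single 0 (D - 1 - a)))
      (fun a : Fin D => lcoeff K (Finsupp.single 2 (a : ℕ) + Finsupp.single 0 (D - a))))
    (fun a b => ?_) (fun a b => ?_) (fun a b => ?_)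
  · -- block 1: kill `x₂`
    have he : (Finsupp.single (1 : Fin 3) ((a : ℕ) + 1) + Finsupp.single (0 : Fin 3) (D - 1 - (a : ℕ)) :
        Fin 3 →₀ ℕ) 2 = 0 := by
      simp
    simp only [Sum.elim_inl, lcoeff_apply]
    rw [← coeff_aeval_kill_of_apply_eq_zero 2 _ he]
    simp only [map_sub, map_mul, map_pow, linSubst_regularModel_X_zero, linSubst_regularModel_X_two,
      map_add, aeval_X, Fin.reduceEq, if_true, if_false, add_zero]
    rw [zero_pow (Nat.succ_ne_zero _), zero_mul, sub_zero, X_pow_eq_monomial, X_pow_eq_monomial,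
      monomial_mul, mul_one, coeff_monomial]
    by_cases hab : a = b
    · subst hab; simp
    · rw [if_neg hab, if_neg]
      intro h
      exact hab (Fin.ext (by have := eq_of_single_add_single_eq (by decide) h; omega)).symm
  · -- block 2: kill `x₁`
    have he : (Finsupp.single (2 : Fin 3) (a : ℕ) + Finsupp.single (0 : Fin 3) (D - (a : ℕ)) :
        Fin 3 →₀ ℕ) 1 = 0 := by
      simp
    simp only [Sum.elim_inr, lcoeff_apply]
    rw [← coeff_aeval_kill_of_apply_eq_zero 1 _ he]
    simp only [map_sub, map_mul, map_pow, linSubst_regularModel_X_zero, linSubst_regularModel_X_one,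
      linSubst_regularModel_X_two, map_add, aeval_X, Fin.reduceEq, if_true, if_false, add_zero,
      zero_add, mul_zero, zero_mul, sub_zero]
    have hb : (D - 1 - (b : ℕ)) + 1 = D - b := by omega
    rw [mul_assoc, ← pow_succ', hb, X_pow_eq_monomial, X_pow_eq_monomial, monomial_mul, mul_one,
      coeff_monomial]
    by_cases hab : a = b
    · subst hab; simp
    · rw [if_neg hab, if_neg]
      intro h
      exact hab (Fin.ext (eq_of_single_add_single_eq (by decide) h)).symm
  · -- block 2 functionals kill block 1 vectors: kill `x₁`
    have he : (Finsupp.single (2 : Fin 3) (a : ℕ) + Finsupp.single (0 : Fin 3) (D - (a : ℕ)) :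
        Fin 3 →₀ ℕ) 1 = 0 := by
      simp
    simp only [Sum.elim_inr, Sum.elim_inl, lcoeff_apply]
    rw [← coeff_aeval_kill_of_apply_eq_zero 1 _ he]
    simp only [map_sub, map_mul, map_pow, linSubst_regularModel_X_zero,
      linSubst_regularModel_X_two, map_add, aeval_X, Fin.reduceEq, if_true, if_false, zero_add,
      sub_self, coeff_zero]

/-- **`dim (Sym^D K³)^{u₀} ≤ N - 2D`** for the model regular unipotent `u₀ = 1 + E₀₁ + E₁₂` and every
`D` (rank–nullity with the `2D` independent images above).
[cite: Poonen2005, Thm. 3 (proof: dimension count of [MM]; fixed forms of the regular unipotent class)] -/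
theorem finrank_fixedForms_regularModel_add_le (D : ℕ) :
    Module.finrank K ↥(homogeneousSubmodule (Fin 3) K D ⊓
        LinearMap.ker ((linSubst (Fin 3) K
          (1 + (Matrix.single 0 1 (1 : K) + Matrix.single 1 2 1))).toLinearMap - LinearMap.id)) +
      2 * D ≤ (degMonomials (Fin 3) D).card := by
  classical
  have h := finrank_fixedForms_add_card_le_card_degMonomials D
    (1 + (Matrix.single 0 1 (1 : K) + Matrix.single 1 2 1))
    (Sum.elim (fun a : Fin D => X 2 ^ ((a : ℕ) + 1) * X 0 ^ (D - 1 - a))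
      (fun a : Fin D => (X 2 ^ (a : ℕ) * X 1 * X 0 ^ (D - 1 - a) : MvPolynomial (Fin 3) K)))
    (fun i => ?_) (linearIndependent_regularModel_images D)
  · simpa [Fintype.card_sum, Fintype.card_fin, two_mul] using h
  · rcases i with a | a
    · simp only [Sum.elim_inl]
      have key : 1 * ((a : ℕ) + 1) + 1 * (D - 1 - (a : ℕ)) = D := by omega
      have h := ((isHomogeneous_X K (2 : Fin 3)).pow ((a : ℕ) + 1)).mul
        ((isHomogeneous_X K (0 : Fin 3)).pow (D - 1 - (a : ℕ)))
      rwa [key] at h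
    · simp only [Sum.elim_inr]
      have key : 1 * (a : ℕ) + 1 + 1 * (D - 1 - (a : ℕ)) = D := by omega
      have h := (((isHomogeneous_X K (2 : Fin 3)).pow (a : ℕ)).mul (isHomogeneous_X K (1 : Fin 3))).mul
        ((isHomogeneous_X K (0 : Fin 3)).pow (D - 1 - (a : ℕ)))
      rwa [key] at h

end Model

/-! ### § 3 The chart `P = [N² eᵢ | N eᵢ | eᵢ]` -/

section Chart

variable {K : Type*} [Field K]

/-- A nilpotent `3 × 3` matrix over a field has cube zero (Cayley–Hamilton: its characteristic
polynomial is `X³`). [cite: Poonen2005, Thm. 3 (proof: dimension count of [MM]; unipotent classes)] -/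
theorem pow_three_eq_zero_of_isNilpotent {N : Matrix (Fin 3) (Fin 3) K} (hN : IsNilpotent N) :
    N ^ 3 = 0 := by
  have h := (Matrix.isNilpotent_charpoly_sub_pow_of_isNilpotent hN).eq_zero
  rw [sub_eq_zero, Fintype.card_fin] at h
  have := Matrix.aeval_self_charpoly N
  rwa [h, map_pow, Polynomial.aeval_X] at this

/-- **The chart conjugates.** For `u = 1 + N` with `N³ = 0`, the matrix `P = [N² eᵢ | N eᵢ | eᵢ]`
(columns) satisfies `u P = P u₀` with the model `u₀ = 1 + E₀₁ + E₁₂` (`N` shifts the columns of `P`).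
[cite: Poonen2005, Thm. 3 (proof: dimension count of [MM]; normal form of the regular unipotent class)] -/
theorem regularChart_conj {N : Matrix (Fin 3) (Fin 3) K} (h3 : N ^ 3 = 0) (i : Fin 3) :
    (1 + N) * Matrix.of (fun r c : Fin 3 =>
        if c = 0 then (N * N) r i else if c = 1 then N r i else if r = i then (1 : K) else 0) =
      Matrix.of (fun r c : Fin 3 =>
        if c = 0 then (N * N) r i else if c = 1 then N r i else if r = i then (1 : K) else 0) *
        (1 + (Matrix.single 0 1 (1 : K) + Matrix.single 1 2 1)) := by
  classical
  set M := N * N with hM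
  have hNM : ∀ r, N r 0 * M 0 i + N r 1 * M 1 i + N r 2 * M 2 i = 0 := by
    intro r
    have h := h3
    rw [pow_three, ← hM] at h
    have := congrFun (congrFun h r) i
    simpa [Matrix.mul_apply, Fin.sum_univ_three] using this
  have hMri : ∀ r, N r 0 * N 0 i + N r 1 * N 1 i + N r 2 * N 2 i = M r i := by
    intro r
    rw [hM, Matrix.mul_apply, Fin.sum_univ_three]
  rw [Matrix.add_mul, Matrix.one_mul, Matrix.mul_add, Matrix.mul_one, add_right_inj]
  ext r c
  rw [Matrix.mul_apply, Matrix.mul_apply]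
  fin_cases c
  · simpa [Matrix.of_apply, Matrix.add_apply, Matrix.single_apply, Fin.sum_univ_three] using hNM r
  · simpa [Matrix.of_apply, Matrix.add_apply, Matrix.single_apply, Fin.sum_univ_three] using hMri r
  · simp [Matrix.of_apply, Matrix.add_apply, Matrix.single_apply, mul_ite, Finset.sum_ite_eq']

/-- **The chart is invertible** when `N² eᵢ ≠ 0` (`N³ = 0`): the columns `N² eᵢ, N eᵢ, eᵢ` are
linearly independent (apply `N²`, then `N`). [cite: Poonen2005, Thm. 3 (proof: dimension count of
[MM]; normal form of the regular unipotent class)] -/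
theorem regularChart_det_ne_zero {N : Matrix (Fin 3) (Fin 3) K} (h3 : N ^ 3 = 0) (i : Fin 3)
    (hi : (fun r => (N * N) r i) ≠ 0) :
    (Matrix.of (fun r c : Fin 3 =>
        if c = 0 then (N * N) r i else if c = 1 then N r i else if r = i then (1 : K) else 0)).det ≠
      0 := by
  classical
  obtain ⟨r₀, hr₀⟩ := Function.ne_iff.mp hi
  have hN3 : N * (N * N) = 0 := by rw [← pow_three]; exact h3
  have hN3' : N * N * N = 0 := by rw [Matrix.mul_assoc, hN3]
  have hN4 : N * N * (N * N) = 0 := by rw [Matrix.mul_assoc, hN3, Matrix.mul_zero]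
  set P : Matrix (Fin 3) (Fin 3) K := Matrix.of (fun r c : Fin 3 =>
    if c = 0 then (N * N) r i else if c = 1 then N r i else if r = i then (1 : K) else 0) with hP
  suffices hU : IsUnit P from ((Matrix.isUnit_iff_isUnit_det P).mp hU).ne_zero
  rw [← Matrix.linearIndependent_cols_iff_isUnit, Fintype.linearIndependent_iff]
  intro g hg
  -- the vanishing combination, coordinatewise
  have hv : ∀ r, g 0 * (N * N) r i + g 1 * N r i + g 2 * (if r = i then 1 else 0) = 0 := by
    intro r
    have := congrFun hg r
    simpa [Fin.sum_univ_three, Matrix.col, hP, Matrix.of_apply] using this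
  -- apply a matrix `A` to it
  have happ : ∀ (A : Matrix (Fin 3) (Fin 3) K) (i' : Fin 3),
      g 0 * (A * (N * N)) i' i + g 1 * (A * N) i' i + g 2 * A i' i = 0 := by
    intro A i'
    have h0 : ∑ r, A i' r * (g 0 * (N * N) r i + g 1 * N r i + g 2 * (if r = i then 1 else 0)) = 0 :=
      Finset.sum_eq_zero fun r _ => by rw [hv r, mul_zero]
    have h1 : ∀ r, A i' r * (g 0 * (N * N) r i + g 1 * N r i + g 2 * (if r = i then 1 else 0)) =
        g 0 * (A i' r * (N * N) r i) + g 1 * (A i' r * N r i) +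
          g 2 * (if r = i then A i' r else 0) := by
      intro r
      split_ifs <;> ring
    simp only [h1, Finset.sum_add_distrib, ← Finset.mul_sum, Finset.sum_ite_eq', Finset.mem_univ,
      if_true] at h0
    simpa [Matrix.mul_apply] using h0
  have h2 : g 2 = 0 := by
    have := happ (N * N) r₀
    rw [hN4, hN3', Matrix.zero_apply, mul_zero, mul_zero, zero_add, zero_add] at this
    exact (mul_eq_zero.mp this).resolve_right hr₀
  have h1 : g 1 = 0 := by
    have := happ N r₀
    rw [hN3, Matrix.zero_apply, mul_zero, zero_add, h2, zero_mul, add_zero] at this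
    exact (mul_eq_zero.mp this).resolve_right hr₀
  have h0 : g 0 = 0 := by
    have := hv r₀
    rw [h1, h2, zero_mul, zero_mul, add_zero, add_zero] at this
    exact (mul_eq_zero.mp this).resolve_right hr₀
  intro c
  fin_cases c <;> assumption

end Chart

/-! ### § 4 Generic ternary forms have no regular unipotent symmetry -/

section Generic

variable {K : Type*} [Field K] {D : ℕ}

/-- **Generic ternary forms of degree `D ≥ 4` have no regular unipotent symmetry** (every field, any
characteristic): for almost all forms `f` of degree `D` in `3` variables, every `u ∈ stab(f)` with
`u - 1` nilpotent satisfies `(u - 1)² = 0`. The Matsumura–Monsky count for the regular unipotent class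
of `GL₃`: the class has dimension `6` (chart `[N² eᵢ | N eᵢ | eᵢ]` in the `6` parameters
`N² eᵢ, N eᵢ`, three charts), its fixed forms span at most `N - 2D` dimensions, and
`6 + (N - 2D) < N ⇔ D ≥ 4`. [cite: Poonen2005, Thm. 3 (proof: dimension count of [MM]; regular
unipotent class, n = 1)] -/
theorem isZariskiGeneric_forall_mem_linStabilizer_unipotent_sq_eq_zero (hD : 4 ≤ D) :
    IsZariskiGeneric D fun f : MvPolynomial (Fin 3) K =>
      ∀ u ∈ linStabilizer f, IsNilpotent ((u : Matrix (Fin 3) (Fin 3) K) - 1) →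
        ((u : Matrix (Fin 3) (Fin 3) K) - 1) ^ 2 = 0 := by
  classical
  -- one chart per `i : Fin 3`
  have hgen : ∀ i : Fin 3, IsZariskiGeneric D fun f : MvPolynomial (Fin 3) K =>
      ∀ u ∈ linStabilizer f, ∀ π : Fin 3 ⊕ Fin 3 → K,
        ((Matrix.of fun r c : Fin 3 =>
            if c = 0 then X (Sum.inl r) else if c = 1 then X (Sum.inr r)
            else if r = i then (1 : MvPolynomial (Fin 3 ⊕ Fin 3) K) else 0).map
          (MvPolynomial.eval π)).det ≠ 0 →
        (u : Matrix (Fin 3) (Fin 3) K) *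
            (Matrix.of fun r c : Fin 3 =>
              if c = 0 then X (Sum.inl r) else if c = 1 then X (Sum.inr r)
              else if r = i then (1 : MvPolynomial (Fin 3 ⊕ Fin 3) K) else 0).map
            (MvPolynomial.eval π) ≠
          (Matrix.of fun r c : Fin 3 =>
              if c = 0 then X (Sum.inl r) else if c = 1 then X (Sum.inr r)
              else if r = i then (1 : MvPolynomial (Fin 3 ⊕ Fin 3) K) else 0).map
            (MvPolynomial.eval π) * (1 + (Matrix.single 0 1 (1 : K) + Matrix.single 1 2 1)) :=
    fun i => isZariskiGeneric_forall_mem_linStabilizer_mul_ne D _ _ (by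
      have := finrank_fixedForms_regularModel_add_le (K := K) D
      simp only [Fintype.card_sum, Fintype.card_fin]
      omega)
  obtain ⟨F, hF0, hF⟩ := IsZariskiGeneric.forall_fintype hgen
  refine ⟨F, hF0, fun f hf hFf u hu hnil => ?_⟩
  by_contra hsq
  set N : Matrix (Fin 3) (Fin 3) K := (u : Matrix (Fin 3) (Fin 3) K) - 1 with hNdef
  have hu1 : (u : Matrix (Fin 3) (Fin 3) K) = 1 + N := by rw [hNdef, add_sub_cancel]
  have h3 : N ^ 3 = 0 := pow_three_eq_zero_of_isNilpotent hnil
  -- some column of `N²` is nonzero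
  obtain ⟨i, hi⟩ : ∃ i : Fin 3, (fun r => (N * N) r i) ≠ 0 := by
    by_contra hall
    push Not at hall
    apply hsq
    rw [pow_two]
    ext r c
    exact congrFun (hall c) r
  -- the chart at `π = (N² eᵢ, N eᵢ)` is `[N² eᵢ | N eᵢ | eᵢ]`
  have hmap : (Matrix.of fun r c : Fin 3 =>
        if c = 0 then X (Sum.inl r) else if c = 1 then X (Sum.inr r)
        else if r = i then (1 : MvPolynomial (Fin 3 ⊕ Fin 3) K) else 0).map
      (MvPolynomial.eval (Sum.elim (fun r => (N * N) r i) fun r => N r i)) =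
      Matrix.of (fun r c : Fin 3 =>
        if c = 0 then (N * N) r i else if c = 1 then N r i else if r = i then (1 : K) else 0) := by
    ext r c
    simp only [Matrix.map_apply, Matrix.of_apply]
    split_ifs <;> simp
  have key := hF f hf hFf i u hu (Sum.elim (fun r => (N * N) r i) fun r => N r i)
  rw [hmap, hu1] at key
  exact key (regularChart_det_ne_zero h3 i hi) (regularChart_conj h3 i)

end Generic



end Literature.Computability.AlgebraicComplexity

end
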